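import Literature.MathematicalPhysics.QuantumFieldTheory.Balaban1983to89.Node00.OpsYBlockPinOfRecord
import Literature.MathematicalPhysics.QuantumFieldTheory.Balaban1983to89.B9CoReadingCoordsGlob

/-!
# `Balaban1983to89.Node00.OpsYBlockPinOfRecordB` — THE BLOCK KEY OF RECORD OF THE BOND SECTOR `blkOfBK : (b, ν, a, c) ↦ Δ(b₋) := blkV1 b`
# INTO n06-c's ALL-BLOCKS GEOMETRY `geoBK ∕ geoBY`, ITS READING LAWS (hypothesis-free `off ∕ bound`, the (3.41) prefactor `lenFB`), AND THE
# DICTIONARY WITH THE INDEX-BOND KEY OF RECORD `blkBK bI` (`bI := bIOfRecord ∕ bIYOfRecord`): prefactors EQUAL, key blocks within torus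
# distance `1`, keys EQUAL on carrier blocks, decay factors within `e^{δ}` — the bond-sector twin of `Node00.OpsYBlockPinOfRecord`
# (NODE 00, owner file of the `OpsY` instance; definition module, count-neutral)

T. Bałaban, *Propagators and renormalization transformations for lattice gauge theories. II*, Commun. Math. Phys. **96** (1984) 223–250
[`Balaban1984PropagatorsII`, "[4]"]: (2.3) p. 224 (*"Λ_j also denotes the set of bonds with at least one end-point in Λ_j"*), (2.45)–(2.46) p. 231
(*"𝔅 = ⋃_j Λ_j"*, the blocks `Δ(y)`, *"d(x, x′) = d(y, y′) if x ∈ B^j(y)"*), (2.51) p. 232 (majorants keyed by the BLOCK OF THE EVALUATION POINT),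
(2.54) p. 233 (the triangle inequality of `d`), p. 248 (*"the same considerations with sites replaced by bonds"* — a bond is placed by its initial
point `b₋`).  T. Bałaban, *Propagators for lattice gauge theories in a background field*, Commun. Math. Phys. **99** (1985) 389–434
[`Balaban1985BackgroundPropagators`, "[B9]"]: p. 397 (*"y, y′ ∈ 𝔅 = ⋃_{j=0}^k Λ_j"*), (3.39) p. 397 (operators on bond functions), (3.41) p. 397
(the weights `(Lʲη)^{−α}`), (3.42) p. 397 (*«for x ∈ Δ(y), y ∈ Λ_j, supp λ ⊂ Δ(y′)»* — the local estimates, block by block over `𝔅`, bond sector included).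

statement-level skeleton of published theorems with citation tags; proofs where landed; nothing here is a claim about the
Yang–Mills mass gap

THE POINT (dag-n06-c g23, bus 2026-08-30T09:49:25Z, ONE PIN ASK: *«the bond block key of record — I key the bond carrier by the lambda
`fun q : XBK κ i => blkV1 i.hN i.D q.1` (block of the bond's initial point, [4] p.231∕p.248; = p21's writer key minus `ιB`); if you mint `blkOfBK κ i`
please make it THAT lambda (rfl) + the two laws vs `blkBK bI` at the record's `bI`: `dist (β (bI b)) (blkV1 b) ≤ 1`, `(geo9K i).len (bI b) = (geoBK i).len
(blkV1 b)`»*).  The N06 certificate's letters of record key the BOND sector `XBK κ i = FBondY i × Fin (d+1) × κ × κ` by INDEX BONDS,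
`B9CoReadingCoords.blkBK bI := bI ∘ fst` (pin `hblkA : 𝔬A.blk = blkBK x.toKIdx bI`), while n06-c's all-blocks (3.42) tables (`B9Local342GOfBlocksXBK`,
`B9BlockKeyTransferXBK`) key it by THE BLOCK OF THE BOND'S INITIAL POINT, `blkV1 b = Δ(b₋) ∈ 𝔅`.  THIS FILE is NODE 00's bond-sector key of record and
its dictionary with `blkBK (bIOfRecord i)`, the exact twin of the site-sector file `Node00.OpsYBlockPinOfRecord` (`blkOfSK`, `sIK`):
* §1 ★ **THE BLOCK KEY OF RECORD OF THE BOND SECTOR** `blkOfBK κ i : XBK κ i → (geoBK i).Site := fun q => blkV1 i.hN i.D q.1` — n06-c's lambda ON THE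
  NOSE (`blkOfBK_eq : blkOfBK κ i = fun q => blkV1 i.hN i.D q.1` and `blkOfBK_apply`, both `rfl`), CANONICAL (no bond map, no choice), DIRECTION-BLIND
  (`blkOfBK_dirBlind`, `rfl`), ONTO `𝔅` (`blkV1_surjective_blocks ∕ exists_blkOfBK_eq`: every block, orphan ones included, is a key value), with
  `scale (blkOfBK q) = j(b₋)` (`rfl`) and the (3.41) prefactor `len (blkOfBK q) = L^{j(b₋)}|c_f|⁻¹ = lenFB i b` (`len_blkOfBK`, n06-k's
  `B9CoReadingCoordsGlob.lenFB`); and the READING LAWS of the bond-sector evaluation `evBK` under this key, HYPOTHESIS-FREE (★ `off_bound_evBK_blkOfBK`: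
  `suppIn λ s → blkOfBK q ≠ s → evBK λ q = 0` and `|evBK λ q| ≤ supNorm λ`; compare `B9CoReadingCoords.off_bound_evBK`, which needs the
  carrier-faithfulness binder `hβI` for the index-bond key);
* §2 ★★ **THE DICTIONARY WITH THE INDEX-BOND KEY OF RECORD** `blkBK (bIOfRecord i)` along the carrier-block map `β`, at EVERY carrier point (no
  corner-freeness) — per carrier point `q` AND per fine bond `b` (n06-c's literal text): the (3.41)∕(3.42) PREFACTORS ARE EQUAL (`len_blkBK_eq_len_blkOfBK`,
  `len_bIOfRecord_eq_len_blkV1 : (geo9K i).len (bIOfRecord i b) = (geoBK i).len (blkV1 i.hN i.D b)`), the scales are equal (`scale_beta_blkBK`), the two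
  key blocks are within torus distance `1` (`dist_beta_blkBK_blkOfBK_le_one`, `dist_beta_bIOfRecord_blkV1_le_one : (geoBK i).dist (β (bIOfRecord i b))
  (blkV1 i.hN i.D b) ≤ 1` — NODE 00's law `bIOfRecord_hβ1` in `geoBK` typing), the keys AGREE on carrier blocks (`beta_blkBK_eq_blkOfBK_of_exists`) and
  everywhere at a corner-free member (`beta_blkBK_eq_blkOfBK_of_surjective`), hence `|d(β (blkBK bI q), t) − d(blkOfBK q, t)| ≤ 1` for every block `t`
  ((2.54); `abs_dist_beta_blkBK_sub_dist_blkOfBK_le_one`), in the record's own currency `|(geo9K i).dist (blkBK bI q) c − (geoBK i).dist (blkOfBK q) (β c)|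
  ≤ 1` (`abs_dist_geo9K_sub_dist_blkOfBK_le_one`), and the (3.42) decay factors compare within `e^{δ}` both ways (`exp_dist_blkOfBK_le ∕
  exp_dist_beta_blkBK_le ∕ exp_dist_blkOfBK_beta_le`, `0 ≤ δ`);
* §3 the same at the record `θ : Stage3Params` in the certificate's binder text (`x : MemberY θ.d₆ …`, geometry `geoBY x`, `bI := bIYOfRecord θ M⋆ x`),
  in BOTH spellings of the block key (the named `blkOfBK κ x.toKIdx q` and n06-c's raw `blkV1 x.toKIdx.hN x.toKIdx.D q.1`, equal by `rfl`):
  ★★ `len_blkBK_bIYOfRecord_eq ∕ len_blkBK_bIYOfRecord_eq_blkV1 ∕ len_bIYOfRecord_eq_len_blkV1`, ★★ `dist_beta_blkBK_bIYOfRecord_le_one ∕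
  dist_beta_blkBK_bIYOfRecord_blkV1_le_one ∕ dist_beta_bIYOfRecord_blkV1_le_one`, `beta_blkBK_bIYOfRecord_eq_of_exists`,
  `abs_dist_geo9Y_sub_dist_blkOfBK_le_one`, `exp_dist_blkOfBK_beta_le_record`, `off_bound_evBK_blkOfBK_record` — the two laws n06-c's generic key
  transfer `B9BlockKeyTransferXBK.hasMajorant_keyTransfer` (✓, 2026-08-30) displays at `X := XBK κ x.toKIdx`, `blkB := blkOfBK κ x.toKIdx` (or the lambda),
  `blkI := blkBK x.toKIdx (bIYOfRecord θ M⋆ x)`, and the per-bond binders `hβ1 ∕ hlen` of its rows-19 face `B9BlockKeyTransferXBK.local342G_of_blocks_idxPins`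
  (`∀ f, (geoBY x).dist (β (bI f)) (blkV1 … f) ≤ 1`, `∀ f, (geo9Y x).len (bI f) = (geoBY x).len (blkV1 … f)`), discharged BY NAME at `bI := bIYOfRecord θ M⋆ x`:
  `hβ1 := dist_beta_bIYOfRecord_blkV1_le_one θ M⋆ x`, `hlen := len_bIYOfRecord_eq_len_blkV1 θ M⋆ x`.
WHAT THIS DOES NOT DO (honest scope): it does NOT transfer a `HasMajorant` table from one key to the other (n06-c's `B9BlockKeyTransferXBK`, with the
neighbour-block count), and it does NOT supply (3.42) tables at any block — it is the key and its dictionary only.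

HONEST SCOPE.  One definition (`blkOfBK`, a projection composed with NODE 00's V1 block map `blkV1`) and lattice bookkeeping over the tree's own domain
datum, n06-c's geometry and NODE 00's landed laws of the bond map of record (`bIOfRecord_hβI ∕ _hlev ∕ _hβ1 ∕ _hbI0`); nothing of [4] or [B9] asserted; no
bridge, frame or certificate re-typed (n06-d's edition); helper, COUNT-NEUTRAL (0 new named facts); N06 NOT discharged; K1⁹ NOT closed; one finite
`𝕋^{d+1}` programme at fixed `ε` — nothing continuum, nothing about OS axioms or the mass gap.  Cell `pub-ymgap` (HUMAN RULING D-0062), NODE 00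
`pub-ymgap-node00-def-Y` (g31), 2026-08-30; filed `--supports stmt-QuantumFields-20541`.
-/

noncomputable section

namespace Literature.MathematicalPhysics.QuantumFieldTheory.Balaban1983to89.Node00.OpsYBlockPinOfRecordB

open Node00
open B6Geom246MultiLevelBox (bset blkOf exists_blkOf_eq)
open B6Geom246MultiLevelTorus (geomT)
open B6GlobalChartV1 (blkV1 toBox toBox_surjective)
open B6Ineq2142KLevelV1 (lvl β)
open B6KLevelCensusIndexV1 (KIdx abs_le_supNormG)
open B9PinMembersKLevelV1 (MemberY geo9Y)
open B9GeoNormsKLevelV1 (geo9K geo9K_supNorm_nonneg)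
open B9CoReadingCoords (XBK evBK blkBK evDiagK abs_evDiagK_le evDiagK_eq_zero_of)
open B9CoReadingCoordsGlob (lenFB lenFB_pos len_blkBK_eq)
open B9SectBAllBlocksGeometryY (geoBK geoBY dist_beta scale_beta len_beta geoBK_dist_comm geoBK_dist_triangle geoBK_dist_nonneg)
open Node00.OpsYBondMapOfRecord (bIOfRecord bIYOfRecord bIOfRecord_hβI bIOfRecord_hlev bIOfRecord_hβ1 bIOfRecord_hbI0)

variable {d ℓ : ℕ} {hd : 1 ≤ d + 1} {hL : Odd (ℓ + 1) ∧ 1 < ℓ + 1} {b₀ b₁ : ℝ}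
variable {κ : Type}

/-! ## §1 The block key of record of the bond sector, into the all-blocks geometry; its reading laws -/

section Index

variable (i : KIdx d ℓ hd hL b₀ b₁)

variable (κ) in
/-- ★ **THE BLOCK KEY OF RECORD OF THE BOND SECTOR** `blkOfBK κ i : (b, ν, a, c) ↦ Δ(b₋) := blkV1 i.hN i.D b`, the block of 𝔅 containing the bond's
initial point — a site of n06-c's all-blocks geometry `geoBK i`; n06-c's key lambda `fun q : XBK κ i => blkV1 i.hN i.D q.1` on the nose (`blkOfBK_eq`, `rfl`).
[cite: Balaban1984PropagatorsII, (2.45)–(2.46) p.231 + p.248 («sites replaced by bonds»), (2.51) p.232; Balaban1985BackgroundPropagators, (3.42) p.397 («x ∈ Δ(y)»)] -/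
def blkOfBK : XBK κ i → (geoBK i).Site := fun q => blkV1 i.hN i.D q.1

/-- `blkOfBK`, evaluated (`rfl`). [cite: Balaban1984PropagatorsII, (2.45) p.231, bookkeeping] -/
@[simp] theorem blkOfBK_apply (q : XBK κ i) : blkOfBK κ i q = blkV1 i.hN i.D q.1 := rfl

/-- ★ `blkOfBK κ i` IS n06-c's key lambda `fun q : XBK κ i => blkV1 i.hN i.D q.1` (`rfl`). [cite: Balaban1984PropagatorsII, (2.45) p.231 + p.248, dictionary] -/
theorem blkOfBK_eq : blkOfBK κ i = fun q : XBK κ i => blkV1 i.hN i.D q.1 := rfl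

/-- the key equation IS the block equation of the bond. [cite: Balaban1984PropagatorsII, (2.45) p.231, bookkeeping] -/
theorem blkOfBK_eq_iff (q : XBK κ i) (s : (geoBK i).Site) : blkOfBK κ i q = s ↔ blkV1 i.hN i.D q.1 = s := Iff.rfl

/-- the key block is the block `Δ(b₋)` of the bond's initial point in N03's all-blocks site reading (`rfl`). [cite: Balaban1984PropagatorsII, (2.45) p.231 + p.248, dictionary] -/
theorem blkOfBK_eq_blkOf_src (q : XBK κ i) : blkOfBK κ i q = blkOf i.D.toDomains (toBox i.hN q.1.src) := rfl

/-- DIRECTION-BLIND: the key only sees the bond's initial point (`rfl`). [cite: Balaban1984PropagatorsII, p.248 («sites replaced by bonds»), bookkeeping] -/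
theorem blkOfBK_dirBlind (q : XBK κ i) : blkOfBK κ i q = blkOfBK κ i ((⟨q.1.src, 0⟩ : FBondY i), q.2) := rfl

/-- the key does not see the slots `(ν, a, c)` (`rfl`). [cite: Balaban1985BackgroundPropagators, (3.39) p.397, bookkeeping] -/
theorem blkOfBK_slotBlind (b : FBondY i) (σ σ' : Fin (d + 1) × κ × κ) : blkOfBK κ i (b, σ) = blkOfBK κ i (b, σ') := rfl

/-- ★ EVERY block of `𝔅` — orphan blocks of an inner corner included — is the block of (the initial point of) some fine bond (N03's `exists_blkOf_eq` and
the surjectivity of NODE 00's chart `toBox`). [cite: Balaban1984PropagatorsII, (2.45) p.231 («𝔅 = ⋃_j Λ_j»), (2.3) p.224] -/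
theorem blkV1_surjective_blocks : Function.Surjective (fun b : FBondY i => (blkV1 i.hN i.D b : (geoBK i).Site)) := by
  intro s
  obtain ⟨z, hz⟩ := exists_blkOf_eq (D := i.D.toDomains) s
  obtain ⟨x, hx⟩ := toBox_surjective (m := i.m) (K := i.K) i.hN z
  refine ⟨⟨x, 0⟩, ?_⟩
  show blkOf i.D.toDomains (toBox i.hN x) = s
  rw [hx, hz]

/-- ★ … hence every block is a value of the key `blkOfBK` in every slot `(ν, a, c)`. [cite: Balaban1984PropagatorsII, (2.45) p.231] -/
theorem exists_blkOfBK_eq (s : (geoBK i).Site) (ν : Fin (d + 1)) (a c : κ) : ∃ b : FBondY i, blkOfBK κ i (b, ν, a, c) = s :=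
  blkV1_surjective_blocks i s

/-- the scale of the key block is the level `j(b₋)` of the bond's initial point (`rfl`). [cite: Balaban1984PropagatorsII, (2.3)–(2.4) p.224, (2.45) p.231] -/
theorem scale_blkOfBK (q : XBK κ i) : (geoBK i).scale (blkOfBK κ i q) = (blkV1 i.hN i.D q.1).1.1 := rfl

/-- ★ the (3.41) prefactor at the key block IS n06-k's `lenFB i b = L^{j(b₋)}|c_f|⁻¹` — the value `B9CoReadingCoordsGlob.len_blkBK_eq` gives the index-bond
key under level-faithfulness; so the (3.42) prefactors are key-independent. [cite: Balaban1985BackgroundPropagators, (3.41)–(3.42) p.397] -/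
theorem len_blkOfBK (q : XBK κ i) : (geoBK i).len (blkOfBK κ i q) = lenFB i q.1 := by
  show (((ℓ + 1 : ℕ) : ℝ)) ^ (blkV1 i.hN i.D q.1).1.1 * |i.cf|⁻¹ = _
  rw [lenFB]
  push_cast
  rfl

/-- the same for the raw key value `blkV1 b`. [cite: Balaban1985BackgroundPropagators, (3.41) p.397, bookkeeping] -/
theorem len_blkV1_eq_lenFB (b : FBondY i) : (geoBK i).len (blkV1 i.hN i.D b) = lenFB i b := by
  show (((ℓ + 1 : ℕ) : ℝ)) ^ (blkV1 i.hN i.D b).1.1 * |i.cf|⁻¹ = _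
  rw [lenFB]
  push_cast
  rfl

/-- `0 < len (blkOfBK q)`. [cite: Balaban1985BackgroundPropagators, (3.41) p.397, bookkeeping] -/
theorem len_blkOfBK_pos (q : XBK κ i) : 0 < (geoBK i).len (blkOfBK κ i q) := by
  rw [len_blkOfBK]; exact lenFB_pos i q.1

/-- ★ **THE READING LAWS UNDER THE BLOCK KEY, HYPOTHESIS-FREE**: n06-k's bond-sector evaluation `evBK` (`.inr J ↦ evDiagK J`, `.inl f ↦ 0`) is OFF outside
the localising block (`suppIn λ s`, read AT the block `s` by `geoBK` — for a bond function «supp J ⊂ Δ(s)» means `J b ≠ 0 → blkV1 b = s` — and `Δ(b₋) ≠ s` give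
`evBK λ (b, …) = 0`) and BOUNDED by `supNorm λ` — the `off ∕ bound` fields of a walk reading keyed by `blkOfBK` (compare `B9CoReadingCoords.off_bound_evBK`,
which needs the carrier-faithfulness binder `hβI` for the index-bond key `blkBK bI`).
[cite: Balaban1985BackgroundPropagators, (3.42) p.397 («supp λ ⊂ Δ(y′)», «|λ|»), (3.39) p.397; Balaban1984PropagatorsII, (2.51) p.232] -/
theorem off_bound_evBK_blkOfBK [DecidableEq κ] :
    (∀ (lam : (geoBK i).Loc) (s : (geoBK i).Site), (geoBK i).suppIn lam s → ∀ q : XBK κ i, blkOfBK κ i q ≠ s → evBK (κ := κ) i lam q = 0) ∧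
    (∀ (lam : (geoBK i).Loc) (q : XBK κ i), |evBK (κ := κ) i lam q| ≤ (geoBK i).supNorm lam) := by
  refine ⟨?_, ?_⟩
  · intro lam s hs q hne
    cases lam with
    | inl f => rfl
    | inr J =>
        refine evDiagK_eq_zero_of ?_
        by_contra hJ
        exact hne (hs q.1 hJ)
  · intro lam q
    cases lam with
    | inl f => show |(0 : ℝ)| ≤ _; rw [abs_zero]; exact geo9K_supNorm_nonneg i _
    | inr J => exact (abs_evDiagK_le J q).trans (abs_le_supNormG i J q.1)

/-! ## §2 The dictionary with the index-bond key of record `blkBK (bIOfRecord i)` along `β` — per carrier point and per fine bond -/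

/-- ★ **ON CARRIER BLOCKS THE TWO KEYS AGREE**: if `Δ(b₋)` carries an index bond, `β (blkBK bI q) = blkOfBK q` at `bI := bIOfRecord i` (NODE 00's law `hβI`).
[cite: Balaban1984PropagatorsII, (2.45)–(2.46) p.231; Balaban1985BackgroundPropagators, (3.42) p.397] -/
theorem beta_blkBK_eq_blkOfBK_of_exists (q : XBK κ i) (h : ∃ c : IBondY i, blkV1 i.hN i.D q.1 = β i.hN i.D i.hk c) :
    β i.hN i.D i.hk (blkBK i (bIOfRecord i) q) = blkOfBK κ i q := by
  obtain ⟨c, hc⟩ := h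
  exact bIOfRecord_hβI i q.1 c hc

/-- per fine bond: `blkV1 b = β c → β (bIOfRecord i b) = blkV1 b`. [cite: Balaban1984PropagatorsII, (2.45)–(2.46) p.231, bookkeeping] -/
theorem beta_bIOfRecord_eq_blkV1_of_exists (b : FBondY i) (h : ∃ c : IBondY i, blkV1 i.hN i.D b = β i.hN i.D i.hk c) :
    (β i.hN i.D i.hk (bIOfRecord i b) : (geoBK i).Site) = blkV1 i.hN i.D b := by
  obtain ⟨c, hc⟩ := h
  exact bIOfRecord_hβI i b c hc

/-- at a corner-free member (`β` onto `𝔅`) the two keys agree EVERYWHERE. [cite: Balaban1984PropagatorsII, (2.45)–(2.46) p.231 + p.248] -/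
theorem beta_blkBK_eq_blkOfBK_of_surjective (hβ : Function.Surjective (β i.hN i.D i.hk)) (q : XBK κ i) :
    β i.hN i.D i.hk (blkBK i (bIOfRecord i) q) = blkOfBK κ i q := by
  obtain ⟨c, hc⟩ := hβ (blkV1 i.hN i.D q.1)
  exact beta_blkBK_eq_blkOfBK_of_exists i q ⟨c, hc.symm⟩

/-- the SCALES of the two key blocks are equal at every carrier point (level-faithfulness `hlev` + [4] (2.3)). [cite: Balaban1984PropagatorsII, (2.3)–(2.4) p.224, (2.45) p.231] -/
theorem scale_beta_blkBK (q : XBK κ i) :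
    (geoBK i).scale (β i.hN i.D i.hk (blkBK i (bIOfRecord i) q)) = (geoBK i).scale (blkOfBK κ i q) := by
  rw [← scale_beta]
  exact bIOfRecord_hlev i q.1

/-- ★★ **THE (3.41)∕(3.42) PREFACTORS ARE KEY-INDEPENDENT**: `(geo9K i).len (blkBK bI q) = (geoBK i).len (blkOfBK q)` at `bI := bIOfRecord i`, every `q`.
[cite: Balaban1985BackgroundPropagators, (3.41)–(3.42) p.397; Balaban1984PropagatorsII, (2.3) p.224] -/
theorem len_blkBK_eq_len_blkOfBK (q : XBK κ i) :
    (geo9K i).len (blkBK i (bIOfRecord i) q) = (geoBK i).len (blkOfBK κ i q) := by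
  rw [len_blkBK_eq i (bIOfRecord_hlev i), len_blkOfBK]

/-- ★★ n06-c's literal text, per fine bond: `(geo9K i).len (bI b) = (geoBK i).len (blkV1 b)` at `bI := bIOfRecord i`.
[cite: Balaban1985BackgroundPropagators, (3.41)–(3.42) p.397; Balaban1984PropagatorsII, (2.3) p.224] -/
theorem len_bIOfRecord_eq_len_blkV1 (b : FBondY i) : (geo9K i).len (bIOfRecord i b) = (geoBK i).len (blkV1 i.hN i.D b) := by
  rw [len_blkV1_eq_lenFB]
  exact B9Ineq347CoReadingAtLetters.len_bI_eq i (bIOfRecord_hlev i) b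

/-- the same through n06-c's pull-back identity `len_beta`. [cite: Balaban1985BackgroundPropagators, (3.41) p.397, bookkeeping] -/
theorem len_beta_blkBK_eq_len_blkOfBK (q : XBK κ i) :
    (geoBK i).len (β i.hN i.D i.hk (blkBK i (bIOfRecord i) q)) = (geoBK i).len (blkOfBK κ i q) := by
  rw [← len_beta]; exact len_blkBK_eq_len_blkOfBK i q

/-- ★ **1-FAITHFUL**: the two key blocks are within torus distance `1`, at EVERY carrier point (orphan blocks included) — NODE 00's law `bIOfRecord_hβ1` in
`geoBK` typing. [cite: Balaban1984PropagatorsII, (2.46) p.231; Balaban1985BackgroundPropagators, (3.42) p.397] -/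
theorem dist_beta_blkBK_blkOfBK_le_one (q : XBK κ i) :
    (geoBK i).dist (β i.hN i.D i.hk (blkBK i (bIOfRecord i) q)) (blkOfBK κ i q) ≤ 1 :=
  bIOfRecord_hβ1 i q.1

/-- ★ n06-c's literal text, per fine bond: `dist (β (bI b)) (blkV1 b) ≤ 1` at `bI := bIOfRecord i`, in `geoBK`'s distance `d_T`.
[cite: Balaban1984PropagatorsII, (2.46) p.231; Balaban1985BackgroundPropagators, (3.42) p.397] -/
theorem dist_beta_bIOfRecord_blkV1_le_one (b : FBondY i) :
    (geoBK i).dist (β i.hN i.D i.hk (bIOfRecord i b)) (blkV1 i.hN i.D b) ≤ 1 :=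
  bIOfRecord_hβ1 i b

/-- … symmetrically. [cite: Balaban1984PropagatorsII, (2.46) p.231, bookkeeping] -/
theorem dist_blkOfBK_beta_blkBK_le_one (q : XBK κ i) :
    (geoBK i).dist (blkOfBK κ i q) (β i.hN i.D i.hk (blkBK i (bIOfRecord i) q)) ≤ 1 := by
  rw [geoBK_dist_comm]; exact dist_beta_blkBK_blkOfBK_le_one i q

/-- distances FROM the block key are within `1` of those from the index-bond key's carrier block ((2.54)). [cite: Balaban1984PropagatorsII, (2.54) p.233, (2.46) p.231] -/
theorem dist_blkOfBK_le_add_one (q : XBK κ i) (t : (geoBK i).Site) :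
    (geoBK i).dist (blkOfBK κ i q) t ≤ (geoBK i).dist (β i.hN i.D i.hk (blkBK i (bIOfRecord i) q)) t + 1 := by
  have h1 := dist_blkOfBK_beta_blkBK_le_one (κ := κ) i q
  have h2 := geoBK_dist_triangle i (blkOfBK κ i q) (β i.hN i.D i.hk (blkBK i (bIOfRecord i) q)) t
  linarith

/-- … and conversely. [cite: Balaban1984PropagatorsII, (2.54) p.233, (2.46) p.231] -/
theorem dist_beta_blkBK_le_add_one (q : XBK κ i) (t : (geoBK i).Site) :
    (geoBK i).dist (β i.hN i.D i.hk (blkBK i (bIOfRecord i) q)) t ≤ (geoBK i).dist (blkOfBK κ i q) t + 1 := by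
  have h1 := dist_beta_blkBK_blkOfBK_le_one (κ := κ) i q
  have h2 := geoBK_dist_triangle i (β i.hN i.D i.hk (blkBK i (bIOfRecord i) q)) (blkOfBK κ i q) t
  linarith

/-- ★ `|d(β (blkBK bI q), t) − d(blkOfBK q, t)| ≤ 1` for every block `t`. [cite: Balaban1984PropagatorsII, (2.54) p.233, (2.46) p.231] -/
theorem abs_dist_beta_blkBK_sub_dist_blkOfBK_le_one (q : XBK κ i) (t : (geoBK i).Site) :
    |(geoBK i).dist (β i.hN i.D i.hk (blkBK i (bIOfRecord i) q)) t - (geoBK i).dist (blkOfBK κ i q) t| ≤ 1 := by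
  rw [abs_sub_le_iff]
  constructor
  · linarith [dist_beta_blkBK_le_add_one (κ := κ) i q t]
  · linarith [dist_blkOfBK_le_add_one (κ := κ) i q t]

/-- ★★ **IN THE RECORD'S OWN CURRENCY**: the (3.42) distance the certificate reads today, `(geo9K i).dist (blkBK bI q) c`, and the all-blocks distance under
the block key, `(geoBK i).dist (blkOfBK q) (β c)`, differ by at most `1` (n06-c's `dist_beta` + (2.54)). [cite: Balaban1984PropagatorsII, (2.46) p.231, (2.54) p.233; Balaban1985BackgroundPropagators, (3.42) p.397] -/
theorem abs_dist_geo9K_sub_dist_blkOfBK_le_one (q : XBK κ i) (c : IBondY i) :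
    |(geo9K i).dist (blkBK i (bIOfRecord i) q) c - (geoBK i).dist (blkOfBK κ i q) (β i.hN i.D i.hk c)| ≤ 1 := by
  rw [dist_beta]
  exact abs_dist_beta_blkBK_sub_dist_blkOfBK_le_one i q _

/-- ★ the (3.42) DECAY FACTORS compare within `e^{δ}`: `e^{−δ·d(blkOfBK q, t)} ≤ e^{δ}·e^{−δ·d(β (blkBK bI q), t)}` (`0 ≤ δ`).
[cite: Balaban1985BackgroundPropagators, (3.42) p.397; Balaban1984PropagatorsII, (2.51) p.232, (2.54) p.233] -/
theorem exp_dist_blkOfBK_le {δ : ℝ} (hδ : 0 ≤ δ) (q : XBK κ i) (t : (geoBK i).Site) :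
    Real.exp (-(δ * (geoBK i).dist (blkOfBK κ i q) t)) ≤
      Real.exp δ * Real.exp (-(δ * (geoBK i).dist (β i.hN i.D i.hk (blkBK i (bIOfRecord i) q)) t)) := by
  rw [← Real.exp_add, Real.exp_le_exp]
  have h := mul_le_mul_of_nonneg_left (dist_beta_blkBK_le_add_one (κ := κ) i q t) hδ
  linarith

/-- … and conversely `e^{−δ·d(β (blkBK bI q), t)} ≤ e^{δ}·e^{−δ·d(blkOfBK q, t)}`. [cite: Balaban1985BackgroundPropagators, (3.42) p.397; Balaban1984PropagatorsII, (2.54) p.233] -/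
theorem exp_dist_beta_blkBK_le {δ : ℝ} (hδ : 0 ≤ δ) (q : XBK κ i) (t : (geoBK i).Site) :
    Real.exp (-(δ * (geoBK i).dist (β i.hN i.D i.hk (blkBK i (bIOfRecord i) q)) t)) ≤
      Real.exp δ * Real.exp (-(δ * (geoBK i).dist (blkOfBK κ i q) t)) := by
  rw [← Real.exp_add, Real.exp_le_exp]
  have h := mul_le_mul_of_nonneg_left (dist_blkOfBK_le_add_one (κ := κ) i q t) hδ
  linarith

/-- the record-currency form: `e^{−δ·(geoBK).dist (blkOfBK q) (β c)} ≤ e^{δ}·e^{−δ·(geo9K).dist (blkBK bI q) c}`.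
[cite: Balaban1985BackgroundPropagators, (3.42) p.397; Balaban1984PropagatorsII, (2.46) p.231, (2.54) p.233] -/
theorem exp_dist_blkOfBK_beta_le {δ : ℝ} (hδ : 0 ≤ δ) (q : XBK κ i) (c : IBondY i) :
    Real.exp (-(δ * (geoBK i).dist (blkOfBK κ i q) (β i.hN i.D i.hk c))) ≤
      Real.exp δ * Real.exp (-(δ * (geo9K i).dist (blkBK i (bIOfRecord i) q) c)) := by
  rw [dist_beta]; exact exp_dist_blkOfBK_le i hδ q _

/-- the index-bond key of record is DIRECTION-BLIND too (`bIOfRecord_hbI0`), like `blkOfBK`. [cite: Balaban1984PropagatorsII, p.248 («sites replaced by bonds»), bookkeeping] -/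
theorem blkBK_bIOfRecord_dirBlind (q : XBK κ i) : blkBK i (bIOfRecord i) q = blkBK i (bIOfRecord i) ((⟨q.1.src, 0⟩ : FBondY i), q.2) :=
  bIOfRecord_hbI0 i q.1

end Index

/-! ## §3 At the record `θ : Stage3Params`, in the certificate's binder text (`x : MemberY θ.d₆ …`, `geoBY x`, `bI := bIYOfRecord θ M⋆ x`) -/

section Record

variable (θ : Stage3Params) (Mstar : ℕ)

/-- the block key at a member of the record, as a key INTO n06-c's `geoBY x` (`= geoBK x.toKIdx`), evaluated (`rfl`). [cite: Balaban1984PropagatorsII, (2.45) p.231, dictionary] -/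
theorem blkOfBK_geoBY_apply (x : MemberY θ.d₆ θ.ℓ₆ θ.hd' θ.hL' θ.b₀ θ.b₁ Mstar) (q : XBK κ x.toKIdx) :
    (blkOfBK κ x.toKIdx q : (geoBY x).Site) = blkV1 x.toKIdx.hN x.toKIdx.D q.1 := rfl

/-- ★★ at the record: the (3.41)∕(3.42) prefactors of the two keys are EQUAL, `(geo9Y x).len (blkBK (bIYOfRecord θ M⋆ x) q) = (geoBY x).len (blkOfBK q)`.
[cite: Balaban1985BackgroundPropagators, (3.41)–(3.42) p.397; Balaban1984PropagatorsII, (2.3) p.224] -/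
theorem len_blkBK_bIYOfRecord_eq (x : MemberY θ.d₆ θ.ℓ₆ θ.hd' θ.hL' θ.b₀ θ.b₁ Mstar) (q : XBK κ x.toKIdx) :
    (geo9Y x).len (blkBK x.toKIdx (bIYOfRecord θ Mstar x) q) = (geoBY x).len (blkOfBK κ x.toKIdx q) :=
  len_blkBK_eq_len_blkOfBK x.toKIdx q

/-- ★★ the same with n06-c's RAW key value `blkV1 … q.1` (the lambda `fun q => blkV1 x.toKIdx.hN x.toKIdx.D q.1`, β-reduced).
[cite: Balaban1985BackgroundPropagators, (3.41)–(3.42) p.397; Balaban1984PropagatorsII, (2.3) p.224] -/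
theorem len_blkBK_bIYOfRecord_eq_blkV1 (x : MemberY θ.d₆ θ.ℓ₆ θ.hd' θ.hL' θ.b₀ θ.b₁ Mstar) (q : XBK κ x.toKIdx) :
    (geo9Y x).len (blkBK x.toKIdx (bIYOfRecord θ Mstar x) q) = (geoBY x).len (blkV1 x.toKIdx.hN x.toKIdx.D q.1) :=
  len_blkBK_eq_len_blkOfBK x.toKIdx q

/-- ★★ n06-c's literal text at the record, per fine bond: `(geo9Y x).len (bIYOfRecord θ M⋆ x b) = (geoBY x).len (blkV1 b)`.
[cite: Balaban1985BackgroundPropagators, (3.41)–(3.42) p.397; Balaban1984PropagatorsII, (2.3) p.224] -/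
theorem len_bIYOfRecord_eq_len_blkV1 (x : MemberY θ.d₆ θ.ℓ₆ θ.hd' θ.hL' θ.b₀ θ.b₁ Mstar) (b : FBondY x.toKIdx) :
    (geo9Y x).len (bIYOfRecord θ Mstar x b) = (geoBY x).len (blkV1 x.toKIdx.hN x.toKIdx.D b) :=
  len_bIOfRecord_eq_len_blkV1 x.toKIdx b

/-- at the record: on carrier blocks the two keys agree. [cite: Balaban1984PropagatorsII, (2.45)–(2.46) p.231; Balaban1985BackgroundPropagators, (3.42) p.397] -/
theorem beta_blkBK_bIYOfRecord_eq_of_exists (x : MemberY θ.d₆ θ.ℓ₆ θ.hd' θ.hL' θ.b₀ θ.b₁ Mstar) (q : XBK κ x.toKIdx)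
    (h : ∃ c : IBondY x.toKIdx, blkV1 x.toKIdx.hN x.toKIdx.D q.1 = β x.toKIdx.hN x.toKIdx.D x.toKIdx.hk c) :
    β x.toKIdx.hN x.toKIdx.D x.toKIdx.hk (blkBK x.toKIdx (bIYOfRecord θ Mstar x) q) = blkOfBK κ x.toKIdx q :=
  beta_blkBK_eq_blkOfBK_of_exists x.toKIdx q h

/-- ★★ at the record: the two key blocks are within torus distance `1` at every carrier point, `(geoBY x).dist (β (blkBK (bIYOfRecord θ M⋆ x) q)) (blkOfBK q) ≤ 1`.
[cite: Balaban1984PropagatorsII, (2.46) p.231; Balaban1985BackgroundPropagators, (3.42) p.397] -/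
theorem dist_beta_blkBK_bIYOfRecord_le_one (x : MemberY θ.d₆ θ.ℓ₆ θ.hd' θ.hL' θ.b₀ θ.b₁ Mstar) (q : XBK κ x.toKIdx) :
    (geoBY x).dist (β x.toKIdx.hN x.toKIdx.D x.toKIdx.hk (blkBK x.toKIdx (bIYOfRecord θ Mstar x) q)) (blkOfBK κ x.toKIdx q) ≤ 1 :=
  dist_beta_blkBK_blkOfBK_le_one x.toKIdx q

/-- ★★ the same with n06-c's RAW key value `blkV1 … q.1`. [cite: Balaban1984PropagatorsII, (2.46) p.231; Balaban1985BackgroundPropagators, (3.42) p.397] -/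
theorem dist_beta_blkBK_bIYOfRecord_blkV1_le_one (x : MemberY θ.d₆ θ.ℓ₆ θ.hd' θ.hL' θ.b₀ θ.b₁ Mstar) (q : XBK κ x.toKIdx) :
    (geoBY x).dist (β x.toKIdx.hN x.toKIdx.D x.toKIdx.hk (blkBK x.toKIdx (bIYOfRecord θ Mstar x) q)) (blkV1 x.toKIdx.hN x.toKIdx.D q.1) ≤ 1 :=
  dist_beta_blkBK_blkOfBK_le_one x.toKIdx q

/-- ★★ n06-c's literal text at the record, per fine bond: `(geoBY x).dist (β (bIYOfRecord θ M⋆ x b)) (blkV1 b) ≤ 1`.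
[cite: Balaban1984PropagatorsII, (2.46) p.231; Balaban1985BackgroundPropagators, (3.42) p.397] -/
theorem dist_beta_bIYOfRecord_blkV1_le_one (x : MemberY θ.d₆ θ.ℓ₆ θ.hd' θ.hL' θ.b₀ θ.b₁ Mstar) (b : FBondY x.toKIdx) :
    (geoBY x).dist (β x.toKIdx.hN x.toKIdx.D x.toKIdx.hk (bIYOfRecord θ Mstar x b)) (blkV1 x.toKIdx.hN x.toKIdx.D b) ≤ 1 :=
  dist_beta_bIOfRecord_blkV1_le_one x.toKIdx b

/-- ★★ n06-c's TWO LAWS at the record as ONE conjunction, in the binder order of `B9BlockKeyTransferXBK` (distance law, then prefactor law), at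
`blkB := blkOfBK κ x.toKIdx`, `blkI := blkBK x.toKIdx (bIYOfRecord θ M⋆ x)`. [cite: Balaban1984PropagatorsII, (2.46) p.231, (2.3) p.224; Balaban1985BackgroundPropagators, (3.41)–(3.42) p.397] -/
theorem keyLaws_blkBK_bIYOfRecord (x : MemberY θ.d₆ θ.ℓ₆ θ.hd' θ.hL' θ.b₀ θ.b₁ Mstar) :
    (∀ q : XBK κ x.toKIdx,
        (geoBY x).dist (β x.toKIdx.hN x.toKIdx.D x.toKIdx.hk (blkBK x.toKIdx (bIYOfRecord θ Mstar x) q)) (blkOfBK κ x.toKIdx q) ≤ 1) ∧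
    (∀ q : XBK κ x.toKIdx, (geo9Y x).len (blkBK x.toKIdx (bIYOfRecord θ Mstar x) q) = (geoBY x).len (blkOfBK κ x.toKIdx q)) :=
  ⟨dist_beta_blkBK_bIYOfRecord_le_one θ Mstar x, len_blkBK_bIYOfRecord_eq θ Mstar x⟩

/-- ★★ at the record, in the certificate's currency: `|(geo9Y x).dist (blkBK bI q) c − (geoBY x).dist (blkOfBK q) (β c)| ≤ 1` at `bI := bIYOfRecord θ M⋆ x`.
[cite: Balaban1984PropagatorsII, (2.46) p.231, (2.54) p.233; Balaban1985BackgroundPropagators, (3.42) p.397] -/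
theorem abs_dist_geo9Y_sub_dist_blkOfBK_le_one (x : MemberY θ.d₆ θ.ℓ₆ θ.hd' θ.hL' θ.b₀ θ.b₁ Mstar) (q : XBK κ x.toKIdx) (c : IBondY x.toKIdx) :
    |(geo9Y x).dist (blkBK x.toKIdx (bIYOfRecord θ Mstar x) q) c -
        (geoBY x).dist (blkOfBK κ x.toKIdx q) (β x.toKIdx.hN x.toKIdx.D x.toKIdx.hk c)| ≤ 1 :=
  abs_dist_geo9K_sub_dist_blkOfBK_le_one x.toKIdx q c

/-- at the record: the decay factors compare within `e^{δ}` (`0 ≤ δ`), certificate currency on the right.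
[cite: Balaban1985BackgroundPropagators, (3.42) p.397; Balaban1984PropagatorsII, (2.54) p.233] -/
theorem exp_dist_blkOfBK_beta_le_record {δ : ℝ} (hδ : 0 ≤ δ) (x : MemberY θ.d₆ θ.ℓ₆ θ.hd' θ.hL' θ.b₀ θ.b₁ Mstar) (q : XBK κ x.toKIdx)
    (c : IBondY x.toKIdx) :
    Real.exp (-(δ * (geoBY x).dist (blkOfBK κ x.toKIdx q) (β x.toKIdx.hN x.toKIdx.D x.toKIdx.hk c))) ≤
      Real.exp δ * Real.exp (-(δ * (geo9Y x).dist (blkBK x.toKIdx (bIYOfRecord θ Mstar x) q) c)) :=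
  exp_dist_blkOfBK_beta_le x.toKIdx hδ q c

/-- at the record: the reading laws under the block key, hypothesis-free (§1 at `x.toKIdx`). [cite: Balaban1985BackgroundPropagators, (3.42) p.397; Balaban1984PropagatorsII, (2.51) p.232] -/
theorem off_bound_evBK_blkOfBK_record [DecidableEq κ] (x : MemberY θ.d₆ θ.ℓ₆ θ.hd' θ.hL' θ.b₀ θ.b₁ Mstar) :
    (∀ (lam : (geoBY x).Loc) (s : (geoBY x).Site), (geoBY x).suppIn lam s →
        ∀ q : XBK κ x.toKIdx, blkOfBK κ x.toKIdx q ≠ s → evBK (κ := κ) x.toKIdx lam q = 0) ∧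
    (∀ (lam : (geoBY x).Loc) (q : XBK κ x.toKIdx), |evBK (κ := κ) x.toKIdx lam q| ≤ (geoBY x).supNorm lam) :=
  off_bound_evBK_blkOfBK x.toKIdx

end Record

end Literature.MathematicalPhysics.QuantumFieldTheory.Balaban1983to89.Node00.OpsYBlockPinOfRecordB
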